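import Summits.RiemannHypothesis.RiemannHypothesis.Theorems.SoloInformedGroundStateZeroSide
import Literature.NumberTheory.LFunctions.FordZetaZeroRecipSqSum
import HarnessLib

/-!
# A numeric bound for the verified zero-weight sum (handoff prove-1, ATTEMPT-19 §6 (S4), referee E19-2)

`W_{T₀} := Σ_{ρ ∈ weilZeroIndex T₀} m(ρ)/(1 + γ²)²` — the constant through which every window test is an
adversary of the zero-side certificate (`HandoffWindowTestLevel.adversary_level_le`) — satisfies
`W_{T₀} ≤ 0.0463/197 < 2.36·10⁻⁴` for every `T₀`, RH-free: each term is at most `m(ρ)/(197‖ρ‖²)`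
(`‖ρ‖² ≤ 1 + γ²` since `0 < Re ρ < 1`, and `1 + γ² > 197` since `|γ| > 14`,
`FordL33.fourteen_lt_abs_im`), and Ford's `Σ_ρ m(ρ)/‖ρ‖² ≤ 0.0463`
(`sum_zeroOrder_div_norm_sq_le`, Ford 2002 Lemma 3.3) bounds the rest.  This turns the «DERIVED»
constant of ATTEMPT-19 TABLE 3b into a tree statement.  Nothing here bears on the truth of RH.
-/

set_option linter.dupNamespace false  -- the mandated namespace repeats `RiemannHypothesis`

open Finset Literature.NumberTheory.LFunctions

namespace Summit.RiemannHypothesis.RiemannHypothesis.Theorems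

/-- Termwise: for a non-trivial zero, `m(ρ)/(1+γ²)² ≤ (m(ρ)/‖ρ‖²)/197`. -/
theorem weilZeroWeight_le_div (ρ : RHWave0.riemannZetaNontrivialZeros) :
    weilZeroWeight (ρ : ℂ) ≤ (riemannZetaZeroOrder (ρ : ℂ) : ℝ) / ‖(ρ : ℂ)‖ ^ 2 / 197 := by
  have hm : (0 : ℝ) < riemannZetaZeroOrder (ρ : ℂ) := FordL33.order_pos ρ
  have h14 : 14 < |(ρ : ℂ).im| := FordL33.fourteen_lt_abs_im ρ
  have hn : 14 < ‖(ρ : ℂ)‖ := FordL33.fourteen_lt_norm ρ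
  have hre0 : 0 < (ρ : ℂ).re := ZetaZeros.riemannZetaNontrivialZeros.re_pos ρ.2
  have hre1 : (ρ : ℂ).re < 1 := ZetaZeros.riemannZetaNontrivialZeros.re_lt_one ρ.2
  have him2 : 196 < (ρ : ℂ).im ^ 2 := by
    have : (14 : ℝ) ^ 2 < |(ρ : ℂ).im| ^ 2 := by gcongr
    rw [sq_abs] at this; linarith
  have hnorm : ‖(ρ : ℂ)‖ ^ 2 = (ρ : ℂ).re ^ 2 + (ρ : ℂ).im ^ 2 := by
    rw [Complex.sq_norm, Complex.normSq_apply]; ring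
  have hns : ‖(ρ : ℂ)‖ ^ 2 ≤ 1 + (ρ : ℂ).im ^ 2 := by rw [hnorm]; nlinarith
  have hnpos : 0 < ‖(ρ : ℂ)‖ ^ 2 := by positivity
  have hγ : 197 ≤ 1 + (ρ : ℂ).im ^ 2 := by linarith
  unfold weilZeroWeight
  rw [div_div, div_le_div_iff₀ (by positivity) (by positivity)]
  -- m · (‖ρ‖² · 197) ≤ m · (1+γ²)²
  have : ‖(ρ : ℂ)‖ ^ 2 * 197 ≤ (1 + (ρ : ℂ).im ^ 2) ^ 2 := by
    calc ‖(ρ : ℂ)‖ ^ 2 * 197 ≤ (1 + (ρ : ℂ).im ^ 2) * (1 + (ρ : ℂ).im ^ 2) :=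
          mul_le_mul hns hγ (by norm_num) (by positivity)
      _ = (1 + (ρ : ℂ).im ^ 2) ^ 2 := by ring
  exact mul_le_mul_of_nonneg_left this hm.le

/-- **The verified weight sum is below `0.0463/197`** (RH-free, every `T₀`):
`Σ_{ρ ∈ weilZeroIndex T₀} m(ρ)/(1+γ²)² ≤ 0.0463/197`. [cite: Ford2002Millennium, Lemma 3.3] -/
theorem finsum_weilZeroIndex_weight_le (T₀ : ℝ) :
    ∑ᶠ ρ ∈ weilZeroIndex T₀, (riemannZetaZeroOrder ρ : ℝ) / (1 + ρ.im ^ 2) ^ 2 ≤ 0.0463 / 197 := by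
  have e : ∑ᶠ ρ ∈ weilZeroIndex T₀, (riemannZetaZeroOrder ρ : ℝ) / (1 + ρ.im ^ 2) ^ 2 =
      ∑ ρ ∈ weilZeroFinset T₀, weilZeroWeight (ρ : ℂ) :=
    finsum_weilZeroIndex_eq_sum (fun ρ ↦ (riemannZetaZeroOrder ρ : ℝ) / (1 + ρ.im ^ 2) ^ 2) T₀
  rw [e]
  have h1 : ∑ ρ ∈ weilZeroFinset T₀, weilZeroWeight (ρ : ℂ) ≤
      ∑ ρ ∈ weilZeroFinset T₀, (riemannZetaZeroOrder (ρ : ℂ) : ℝ) / ‖(ρ : ℂ)‖ ^ 2 / 197 :=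
    sum_le_sum fun ρ _ ↦ weilZeroWeight_le_div ρ
  have h2 : ∑ ρ ∈ weilZeroFinset T₀, (riemannZetaZeroOrder (ρ : ℂ) : ℝ) / ‖(ρ : ℂ)‖ ^ 2 / 197 =
      (∑ ρ ∈ weilZeroFinset T₀, (riemannZetaZeroOrder (ρ : ℂ) : ℝ) / ‖(ρ : ℂ)‖ ^ 2) / 197 := by
    rw [sum_div]
  have h3 := sum_zeroOrder_div_norm_sq_le (weilZeroFinset T₀)
  rw [h2] at h1
  have h4 : (∑ ρ ∈ weilZeroFinset T₀, (riemannZetaZeroOrder (ρ : ℂ) : ℝ) / ‖(ρ : ℂ)‖ ^ 2) / 197 ≤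
      0.0463 / 197 := div_le_div_of_nonneg_right h3 (by norm_num)
  exact h1.trans h4

end Summit.RiemannHypothesis.RiemannHypothesis.Theorems
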